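import Literature.MathematicalPhysics.QuantumManyBody.PeriodicBoseGasScatteringProfile
import Literature.MathematicalPhysics.QuantumManyBody.ScatteringLengthDifference
import Literature.MathematicalPhysics.QuantumManyBody.SquareWellScatteringLength
import Literature.MathematicalPhysics.QuantumManyBody.BoseGasThermodynamicLimitRuelle
import HarnessLib

/-!
# FGJMOT Lemma 3.3 for potentials with a hard core: `a(V) ≤ a(min(V,K)) + √(2/K)`

Topic `Literature/MathematicalPhysics/QuantumManyBody`, namespace `BoseGas` (provefact
`Literature.MathematicalPhysics.QuantumManyBody.BoseGas.Junge2026_neumannBox_pinnedLowerBound`; brick: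
[FournaisEtAl2024, Lemma 3.3] in the generality used by their Prop. 2.1 — `V` non-increasing of
compact support, **possibly `+∞` on a core** (the hard core is the case of interest of the paper,
"interacting via strong potentials"). The sibling file `ScatteringLengthTruncation.lean` proves the
lemma for BOUNDED `V` by the printed route (Lemma 3.2 via the minimisers of `V` and `min(V,K)`);
for an unbounded `V` the tree has no minimiser, and we give instead a direct variational proof.

**Statement** (`FournaisEtAl2024_lemma33_core`). Let `V : ℝ → ℝ≥0∞` be measurable, `V = 0` beyond
`R₀`, `K > 0`, `0 < R ≤ R₀`, `V ≥ K` on `(0, R]` and `V ≤ K` on `(R, ∞)` (so `{V > K}` is the ball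
of radius `R`, as for the non-increasing `V` of the paper, `R = R_K`). Then
`a(V) ≤ a(min(V, K)) + √(2/K)` (and `a(min(V,K)) ≤ a(V)`, `scatteringLength_min_le`).

**Proof** (trial function = minimiser of the truncation × hard-wall comparison function). Write
`w = min(V, K)` (bounded, so the tree's profile `f = radialProfile w R₀` is available:
`0 < f ≤ 1`, `(r²f')' = ½r²wf`, `T²f'(T) = a(w)` for `T ≥ R₀`), `w_K = K·1_{(0,R]} ≤ w`, whence
`f ≤ f_K = 1 - a_K/r` on `(R, ∞)` (`radialProfile_antitone_pot`) with
`a_K = a(w_K) = R - tanh(R√(K/2))/√(K/2)`, `0 < R - a_K ≤ √(2/K)` (`SquareWellScatteringLength`).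
Put `h(r) = (r - R)/(r - a_K)` (`h(R) = 0`, `h ↑ 1`; it is `(1 - R/r)/f_K`, the hard-core
minimiser divided by `f_K`) and insert into the functional of `V` the `C¹` radial trial function
`g = glue_T[fH, 1]`, `H = glue_R[0, h]`, which vanishes on the ball of radius `R` — so that
`𝓔_V[g] = 𝓔_w[g]` (`V = w` off the ball). The pointwise identity
`r²((fH)'² + ½w(fH)²) = r²f'(fH²)' + r²f²H'² + ½wr²f·(fH²)` and the flux form of the radial
equation (`profile_flux_identity` with `k = fH²`) give
`∫₀ᵀ r²(g'² + ½wg²) = T²f'(T)f(T)H(T)² + ∫₀ᵀ r²f²H'² ≤ a(w) + O(θ) + ∫_R^T (R-a_K)²/(r-a_K)² dr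
 ≤ a(w) + O(θ) + (R - a_K)`,
using `r²f²h'² ≤ (r - a_K)²·(R-a_K)²/(r-a_K)⁴` on `(R, T]`; the cut-off layer `[T, 2T]` costs
`O(1/T)`. Hence `a(V) ≤ a(w) + R - a_K ≤ a(w) + √(2/K)`. (With `w_K` in place of `w` the same
computation is the identity `∫|f_K∇h|² = 4π(R - a_K)` behind Lemma 3.2 for the pair hard core /
well.)

* `profile_mul_energy_eq` — the product identity above, for any `C¹` `H` and bounded `w`;
* `FournaisEtAl2024_lemma33_core` — the lemma in `ℝ≥0∞` form; `…_toReal` — real form.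

No definitions.

## References

* [FournaisEtAl2024] S. Fournais, L. Junge, T. Girardot, L. Morin, M. Olivieri, A. Triay, *The free
  energy of dilute Bose gases at low temperatures interacting via strong potentials*,
  arXiv:2408.14222, Ann. Henri Poincaré (2026): Lemma 3.3, (3.7)–(3.9); Prop. 2.1.
* [LSSY2005] E. H. Lieb, R. Seiringer, J. P. Solovej, J. Yngvason, *The Mathematics of the Bose Gas
  and its Condensation*, Birkhäuser 2005: App. C, Thm. C.1 (C.4)–(C.8), Lemma C.2.
-/

noncomputable section

open MeasureTheory Set Filter Topology Metric
open scoped ENNReal NNReal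

namespace Literature.MathematicalPhysics.QuantumManyBody.BoseGas

/-! ### Calculus helpers -/

section Helpers

/-- The glue of the constant `m` and the identity (across `[m, m + θ]`) is a `C¹` floor: `≥ m`
everywhere. [folklore] -/
theorem le_glue_const_id {θ : ℝ} (hθ : 0 < θ) (m r : ℝ) : m ≤ glue m θ (fun _ => m) id r := by
  rcases le_or_gt r m with hr | hr
  · rw [glue_of_le hθ hr]
  · rw [glue_eq_add]
    have h0 := smoothStep_nonneg (r₀ := m) (θ := θ) r
    simp only [id]
    nlinarith

/-- `∫_a^b (s - c)⁻² ds = 1/(a - c) - 1/(b - c)` for `c < a ≤ b`. [folklore] -/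
theorem integral_inv_sq_shift {c a b : ℝ} (hca : c < a) (hab : a ≤ b) :
    ∫ s in a..b, ((s - c) ^ 2)⁻¹ = 1 / (a - c) - 1 / (b - c) := by
  have h : ∀ s ∈ uIcc a b, HasDerivAt (fun s : ℝ => -(s - c)⁻¹) (((s - c) ^ 2)⁻¹) s := by
    intro s hs
    rw [uIcc_of_le hab] at hs
    have hs0 : s - c ≠ 0 := (sub_pos.2 (hca.trans_le hs.1)).ne'
    have h1 : HasDerivAt (fun y : ℝ => (y - c)⁻¹) (-(1 : ℝ) / (s - c) ^ 2) s :=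
      ((hasDerivAt_id' s).sub_const c).inv hs0
    refine h1.neg.congr_deriv ?_
    rw [neg_div, neg_neg, one_div]
  rw [intervalIntegral.integral_eq_sub_of_hasDerivAt h]
  · simp only [one_div]; ring
  · refine ContinuousOn.intervalIntegrable ?_
    rw [uIcc_of_le hab]
    exact continuousOn_of_forall_continuousAt fun s hs =>
      (((continuous_id.sub continuous_const).pow 2).continuousAt).inv₀
        (pow_ne_zero 2 (sub_pos.2 (hca.trans_le hs.1)).ne')

/-- `∫_{(a,b]} (s - c)⁻² ds = 1/(a - c) - 1/(b - c)` as a lower integral. [folklore] -/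
theorem lintegral_inv_sq_shift {c a b : ℝ} (hca : c < a) (hab : a ≤ b) :
    ∫⁻ s in Ioc a b, ENNReal.ofReal (((s - c) ^ 2)⁻¹) = ENNReal.ofReal (1 / (a - c) - 1 / (b - c)) := by
  have hcont : ContinuousOn (fun s : ℝ => ((s - c) ^ 2)⁻¹) (Icc a b) :=
    continuousOn_of_forall_continuousAt fun s hs =>
      (((continuous_id.sub continuous_const).pow 2).continuousAt).inv₀
        (pow_ne_zero 2 (sub_pos.2 (hca.trans_le hs.1)).ne')
  have hint : IntegrableOn (fun s : ℝ => ((s - c) ^ 2)⁻¹) (Ioc a b) :=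
    (hcont.integrableOn_Icc).mono_set Ioc_subset_Icc_self
  rw [← integral_inv_sq_shift hca hab, intervalIntegral.integral_of_le hab,
    ofReal_integral_eq_lintegral_ofReal hint]
  exact Eventually.of_forall fun s => by positivity

end Helpers

/-! ### The product identity -/

section Product

variable {w : ℝ → ℝ≥0∞} {M : ℝ}

/-- **The energy of `f·H` for the scattering profile `f` of a bounded potential**: for every `C¹`
function `H` and `T > 0`,
`∫₀ᵀ r²((fH)'² + ½w(fH)²) dr = T²f'(T)·f(T)H(T)² + ∫₀ᵀ r²f²H'² dr`
— the pointwise identity `r²((fH)'² + ½wf²H²) = r²f'(fH²)' + r²f²H'² + ½wr²f(fH²)` integrated with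
the flux form of the radial equation `∫₀ᵀ r²f'k' = T²f'(T)k(T) - ∫₀ᵀ ½ws²fk`, `k = fH²`.
[cite: LSSY2005, App. C, Thm. C.1 and Lemma C.2 (ground-state substitution); FournaisEtAl2024, Lemma 3.2, proof] -/
theorem profile_mul_energy_eq (hw : Measurable w) (hM : ∀ r, w r ≤ ENNReal.ofReal M) (hM0 : 0 ≤ M)
    (R : ℝ) {T : ℝ} (hT : 0 < T) {H : ℝ → ℝ} (hH : ContDiff ℝ 1 H) :
    ∫ r in Ioc 0 T, r ^ 2 * (deriv (fun r => radialProfile w R r * H r) r ^ 2 +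
        (w r).toReal / 2 * (radialProfile w R r * H r) ^ 2) =
      T ^ 2 * deriv (radialProfile w R) T * (radialProfile w R T * H T ^ 2) +
        ∫ r in Ioc 0 T, r ^ 2 * radialProfile w R r ^ 2 * deriv H r ^ 2 := by
  set f := radialProfile w R with hf
  have hfc : ContDiff ℝ 1 f := contDiff_radialProfile hw hM hM0
  have hfd : ∀ r, HasDerivAt f (deriv f r) r := fun r => (hfc.differentiable one_ne_zero r).hasDerivAt
  have hHd : ∀ r, HasDerivAt H (deriv H r) r := fun r => (hH.differentiable one_ne_zero r).hasDerivAt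
  have hkc : ContDiff ℝ 1 (fun r => f r * H r ^ 2) := hfc.mul (hH.pow 2)
  have hflux := profile_flux_identity hw hM hM0 R hT hkc
  beta_reduce at hflux
  -- derivative formulas
  have hFH' : ∀ r, deriv (fun r => f r * H r) r = deriv f r * H r + f r * deriv H r := fun r =>
    ((hfd r).fun_mul (hHd r)).deriv
  have hk' : ∀ r, deriv (fun r => f r * H r ^ 2) r = deriv f r * H r ^ 2 + f r * (2 * H r * deriv H r) := by
    intro r
    have h := ((hfd r).fun_mul ((hHd r).fun_pow 2)).deriv
    rw [h]
    simp only [Nat.cast_ofNat]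
    ring
  -- the pointwise identity
  have hpt : ∀ r, r ^ 2 * (deriv (fun r => f r * H r) r ^ 2 + (w r).toReal / 2 * (f r * H r) ^ 2) =
      r ^ 2 * deriv f r * deriv (fun r => f r * H r ^ 2) r +
        (r ^ 2 * f r ^ 2 * deriv H r ^ 2 + (w r).toReal / 2 * r ^ 2 * f r * (f r * H r ^ 2)) := by
    intro r
    rw [hFH', hk']
    ring
  -- integrability on `(0, T]`
  have hcf' : Continuous (deriv f) := hfc.continuous_deriv le_rfl
  have hcH' : Continuous (deriv H) := hH.continuous_deriv le_rfl
  have hck' : Continuous (deriv fun r => f r * H r ^ 2) := hkc.continuous_deriv le_rfl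
  have hi1 : IntegrableOn (fun r => r ^ 2 * deriv f r * deriv (fun r => f r * H r ^ 2) r) (Ioc 0 T) := by
    have : Continuous fun r => r ^ 2 * deriv f r * deriv (fun r => f r * H r ^ 2) r := by fun_prop
    exact this.integrableOn_Icc.mono_set Ioc_subset_Icc_self
  have hi2 : IntegrableOn (fun r => r ^ 2 * f r ^ 2 * deriv H r ^ 2) (Ioc 0 T) := by
    have : Continuous fun r => r ^ 2 * f r ^ 2 * deriv H r ^ 2 := by
      have := hfc.continuous; fun_prop
    exact this.integrableOn_Icc.mono_set Ioc_subset_Icc_self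
  have hi3 : IntegrableOn (fun r => (w r).toReal / 2 * r ^ 2 * f r * (f r * H r ^ 2)) (Ioc 0 T) := by
    have heq : (fun r => (w r).toReal / 2 * r ^ 2 * f r * (f r * H r ^ 2)) =
        fun r => (w r).toReal / 2 * (r ^ 2 * f r * (f r * H r ^ 2)) := by
      funext r; ring
    rw [heq]
    exact integrableOn_Ioc_pot_mul hw hM hM0
      (by have := hfc.continuous; have := hH.continuous; fun_prop) T
  calc ∫ r in Ioc 0 T, r ^ 2 * (deriv (fun r => f r * H r) r ^ 2 + (w r).toReal / 2 * (f r * H r) ^ 2)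
      = ∫ r in Ioc 0 T, (r ^ 2 * deriv f r * deriv (fun r => f r * H r ^ 2) r +
          (r ^ 2 * f r ^ 2 * deriv H r ^ 2 + (w r).toReal / 2 * r ^ 2 * f r * (f r * H r ^ 2))) :=
        setIntegral_congr_fun measurableSet_Ioc fun r _ => hpt r
    _ = (∫ r in Ioc 0 T, r ^ 2 * deriv f r * deriv (fun r => f r * H r ^ 2) r) +
          ((∫ r in Ioc 0 T, r ^ 2 * f r ^ 2 * deriv H r ^ 2) +
            ∫ r in Ioc 0 T, (w r).toReal / 2 * r ^ 2 * f r * (f r * H r ^ 2)) := by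
        have hi23 : IntegrableOn (fun r => r ^ 2 * f r ^ 2 * deriv H r ^ 2 +
            (w r).toReal / 2 * r ^ 2 * f r * (f r * H r ^ 2)) (Ioc 0 T) := hi2.add hi3
        rw [integral_add hi1 hi23, integral_add hi2 hi3]
    _ = _ := by rw [hflux]; ring

end Product


/-! ### More helpers: splitting, the outer cut-off layer, potentials agreeing on `(0, ∞)` -/

section Helpers2

variable {v : ℝ → ℝ≥0∞}

/-- Splitting a lower integral over `(a, c]` at `b`. [folklore] -/
theorem lintegral_Ioc_eq_add {a b c : ℝ} (hab : a ≤ b) (hbc : b ≤ c) (F : ℝ → ℝ≥0∞) :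
    ∫⁻ r in Ioc a c, F r = (∫⁻ r in Ioc a b, F r) + ∫⁻ r in Ioc b c, F r := by
  rw [← Ioc_union_Ioc_eq_Ioc hab hbc,
    lintegral_union measurableSet_Ioc (Ioc_disjoint_Ioc_of_le le_rfl)]

/-- **The derivative on the cut-off layer `[T, 2T]`.** If `G` is `C¹` with `|G'| ≤ A/T²` and
`0 ≤ 1 - G ≤ B/T` on `[T, 2T]` (`T > 0`), then the cut-off profile `G + χ_T(1 - G)`
(`χ_T` the smooth step across `[T, 2T]`, `|χ_T'| ≤ M_χ/T`) has `|(G + χ_T(1-G))'| ≤ (A + M_χB)/T²`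
there. [cite: LSSY2005, App. C, Thm. C.1 (the passage `R → ∞` in (C.8))] -/
theorem abs_deriv_glue_cutoff_le {G : ℝ → ℝ} (hG : ContDiff ℝ 1 G) {T A B Mχ : ℝ} (hT : 0 < T)
    (hMχ : ∀ y ∈ Icc (0 : ℝ) 1, |deriv Real.smoothTransition y| ≤ Mχ) (hMχ0 : 0 ≤ Mχ)
    (hA : ∀ r ∈ Icc T (2 * T), |deriv G r| ≤ A / T ^ 2)
    (hB : ∀ r ∈ Icc T (2 * T), 0 ≤ 1 - G r ∧ 1 - G r ≤ B / T) {r : ℝ} (hr : r ∈ Icc T (2 * T)) :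
    |deriv (glue T T G fun _ => (1 : ℝ)) r| ≤ (A + Mχ * B) / T ^ 2 := by
  have hr' : r ∈ Icc T (T + T) := by rw [← two_mul]; exact hr
  have hχ' := abs_deriv_smoothStep_le (r₀ := T) hT hMχ hr'
  have hχ0 := smoothStep_nonneg (r₀ := T) (θ := T) r
  have hχ1 := smoothStep_le_one (r₀ := T) (θ := T) r
  obtain ⟨hB0, hB1⟩ := hB r hr
  have hA1 := hA r hr
  rw [deriv_glue hG contDiff_const]
  have hc : deriv (fun _ : ℝ => (1 : ℝ)) r = 0 := deriv_const r 1
  rw [hc, mul_zero, add_zero]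
  have h1 : |deriv (smoothStep T T) r * (1 - G r)| ≤ Mχ / T * (B / T) := by
    rw [abs_mul, abs_of_nonneg hB0]
    exact mul_le_mul hχ' hB1 hB0 (div_nonneg hMχ0 hT.le)
  have h2 : |(1 - smoothStep T T r) * deriv G r| ≤ A / T ^ 2 := by
    rw [abs_mul, abs_of_nonneg (by linarith)]
    exact (mul_le_of_le_one_left (abs_nonneg _) (by linarith)).trans hA1
  calc |deriv (smoothStep T T) r * (1 - G r) + (1 - smoothStep T T r) * deriv G r|
      ≤ |deriv (smoothStep T T) r * (1 - G r)| + |(1 - smoothStep T T r) * deriv G r| := abs_add_le _ _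
    _ ≤ Mχ / T * (B / T) + A / T ^ 2 := add_le_add h1 h2
    _ = (A + Mχ * B) / T ^ 2 := by field_simp; ring

/-- **Energy of the cut-off layer**: a derivative bound `|g'| ≤ E` on `[T, 2T]` beyond the range of
the potential gives `∫_{(T,2T]} r²(g'² + ½wg²) ≤ 4T³E²`. [folklore] -/
theorem lintegral_cutoff_layer_le {w : ℝ → ℝ≥0∞} {g : ℝ → ℝ} {T E : ℝ} (hT : 0 < T)
    (hw0 : ∀ r, T < r → w r = 0) (hE : ∀ r ∈ Icc T (2 * T), |deriv g r| ≤ E) :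
    ∫⁻ r in Ioc T (2 * T), rayDensity w g r ≤ ENNReal.ofReal (4 * T ^ 3 * E ^ 2) := by
  have hE0 : 0 ≤ E := (abs_nonneg _).trans (hE T ⟨le_rfl, by linarith⟩)
  calc ∫⁻ r in Ioc T (2 * T), rayDensity w g r
      = ∫⁻ r in Ioc T (2 * T), ENNReal.ofReal (r ^ 2 * deriv g r ^ 2) :=
        setLIntegral_congr_fun measurableSet_Ioc fun r hr => rayDensity_of_eq_zero (hw0 r hr.1)
    _ ≤ ∫⁻ _ in Ioc T (2 * T), ENNReal.ofReal ((2 * T) ^ 2 * E ^ 2) := by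
        refine setLIntegral_mono' measurableSet_Ioc fun r hr => ENNReal.ofReal_le_ofReal ?_
        have h1 : r ^ 2 ≤ (2 * T) ^ 2 := pow_le_pow_left₀ (hT.le.trans hr.1.le) hr.2 2
        have h2 : deriv g r ^ 2 ≤ E ^ 2 := by
          rw [← sq_abs]
          exact pow_le_pow_left₀ (abs_nonneg _) (hE r ⟨hr.1.le, hr.2⟩) 2
        exact mul_le_mul h1 h2 (sq_nonneg _) (by positivity)
    _ = ENNReal.ofReal (4 * T ^ 3 * E ^ 2) := by
        rw [setLIntegral_const, Real.volume_Ioc, show 2 * T - T = T by ring,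
          ← ENNReal.ofReal_mul (by positivity)]
        congr 1
        ring

/-- **The scattering length only sees the potential on `(0, ∞)`** (the origin is a null set).
[folklore] -/
theorem scatteringLength_congr_Ioi {v₁ v₂ : ℝ → ℝ≥0∞} (h : ∀ r, 0 < r → v₁ r = v₂ r) :
    scatteringLength v₁ = scatteringLength v₂ := by
  have key : ∀ φ : Space → ℝ, scatteringFunctional v₁ φ = scatteringFunctional v₂ φ := by
    intro φ
    refine lintegral_congr_ae ?_
    have h0 : ∀ x : Space, x ≠ 0 →
        gradSq φ x + 2⁻¹ * v₁ ‖x‖ * (‖φ x‖₊ : ℝ≥0∞) ^ 2 =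
          gradSq φ x + 2⁻¹ * v₂ ‖x‖ * (‖φ x‖₊ : ℝ≥0∞) ^ 2 := fun x hx => by
      rw [h _ (norm_pos_iff.2 hx)]
    have hae : ∀ᵐ x : Space, x ≠ (0 : Space) := by
      rw [ae_iff]
      refine measure_mono_null (fun x hx => ?_) (measure_singleton (0 : Space))
      simpa using hx
    filter_upwards [hae] with x hx
    exact h0 x hx
  unfold scatteringLength
  simp_rw [key]

end Helpers2

/-! ### Lemma 3.3 with a hard core: the two estimates -/

section Estimates

variable {w : ℝ → ℝ≥0∞} {K R R₀ aK a₂ T θ₁ C_H : ℝ} {f H : ℝ → ℝ}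

/-- **The energy of `fH` on `(0, T]`**: `≤ a(w) + (R+1)²C_H²θ₁ + (R - a_K)`, from the product
identity, `T²f'(T) = a(w)`, `fH² ≤ 1`, `H' = 0` on `(0,R]`, `|H'| ≤ C_H` on the gluing layer and
`r²f²h'² ≤ (R-a_K)²/(r-a_K)²` on `(R+θ₁, T]`. [cite: FournaisEtAl2024, Lemma 3.3; LSSY2005, App. C, (C.8)] -/
theorem lintegral_rayDensity_profile_mul_le (hw : Measurable w) (hM : ∀ r, w r ≤ ENNReal.ofReal K)
    (hK : 0 ≤ K) (hR : 0 < R) (hθ₁0 : 0 < θ₁) (hθ₁1 : θ₁ ≤ 1) (hRT : R + θ₁ ≤ T) (haK : aK < R)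
    (ha₂0 : 0 ≤ a₂) (hf : f = radialProfile w R₀) (hf0 : ∀ r, 0 < f r) (hf1 : ∀ r, f r ≤ 1)
    (hfK : ∀ r, R < r → f r ≤ 1 - aK / r) (hfT : T ^ 2 * deriv f T = a₂) (hH : ContDiff ℝ 1 H)
    (hH01 : ∀ r, 0 ≤ H r ∧ H r ≤ 1) (hH'0 : ∀ r, r ≤ R → deriv H r = 0)
    (hH'C : ∀ r ∈ Icc R (R + θ₁), |deriv H r| ≤ C_H)
    (hH'1 : ∀ r, R + θ₁ ≤ r → r ≤ T → deriv H r = (R - aK) / (r - aK) ^ 2) :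
    ∫⁻ r in Ioc 0 T, rayDensity w (fun r => f r * H r) r ≤
      ENNReal.ofReal a₂ + (ENNReal.ofReal ((R + 1) ^ 2 * C_H ^ 2 * θ₁) + ENNReal.ofReal (R - aK)) := by
  have hT0 : 0 < T := by linarith
  have hfc : ContDiff ℝ 1 f := hf ▸ contDiff_radialProfile hw hM hK
  have hG₁c : ContDiff ℝ 1 fun r => f r * H r := hfc.mul hH
  -- the product identity
  have hid := profile_mul_energy_eq hw hM hK R₀ hT0 hH
  rw [← hf] at hid
  -- the integral of `r² f² H'²`
  have hIc : Continuous fun r => r ^ 2 * f r ^ 2 * deriv H r ^ 2 := by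
    have := hfc.continuous; have := hH.continuous_deriv le_rfl; fun_prop
  have hIint : IntegrableOn (fun r => r ^ 2 * f r ^ 2 * deriv H r ^ 2) (Ioc 0 T) :=
    hIc.integrableOn_Icc.mono_set Ioc_subset_Icc_self
  have hInn : 0 ≤ ∫ r in Ioc 0 T, r ^ 2 * f r ^ 2 * deriv H r ^ 2 :=
    setIntegral_nonneg measurableSet_Ioc fun r _ => by positivity
  have hIeq : ENNReal.ofReal (∫ r in Ioc 0 T, r ^ 2 * f r ^ 2 * deriv H r ^ 2) =
      ∫⁻ r in Ioc 0 T, ENNReal.ofReal (r ^ 2 * f r ^ 2 * deriv H r ^ 2) :=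
    ofReal_integral_eq_lintegral_ofReal hIint (Eventually.of_forall fun r => by positivity)
  -- the three pieces of `∫ r² f² H'²`
  have hI1 : ∫⁻ r in Ioc 0 R, ENNReal.ofReal (r ^ 2 * f r ^ 2 * deriv H r ^ 2) = 0 := by
    rw [setLIntegral_congr_fun measurableSet_Ioc (g := fun _ => 0) fun r hr => ?_, lintegral_zero]
    rw [hH'0 r hr.2]; simp
  have hI2 : ∫⁻ r in Ioc R (R + θ₁), ENNReal.ofReal (r ^ 2 * f r ^ 2 * deriv H r ^ 2) ≤
      ENNReal.ofReal ((R + 1) ^ 2 * C_H ^ 2 * θ₁) := by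
    calc ∫⁻ r in Ioc R (R + θ₁), ENNReal.ofReal (r ^ 2 * f r ^ 2 * deriv H r ^ 2)
        ≤ ∫⁻ r in Ioc R (R + θ₁), ENNReal.ofReal (r ^ 2 * deriv H r ^ 2) := by
          refine lintegral_mono fun r => ENNReal.ofReal_le_ofReal ?_
          have hf2 : f r ^ 2 ≤ 1 := pow_le_one₀ (hf0 r).le (hf1 r)
          have h0 : 0 ≤ r ^ 2 * deriv H r ^ 2 := by positivity
          calc r ^ 2 * f r ^ 2 * deriv H r ^ 2 = (r ^ 2 * deriv H r ^ 2) * f r ^ 2 := by ring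
            _ ≤ (r ^ 2 * deriv H r ^ 2) * 1 := mul_le_mul_of_nonneg_left hf2 h0
            _ = r ^ 2 * deriv H r ^ 2 := mul_one _
      _ ≤ _ := layer_lintegral_le hR.le hθ₁0 hθ₁1 hH'C
  have hI3 : ∫⁻ r in Ioc (R + θ₁) T, ENNReal.ofReal (r ^ 2 * f r ^ 2 * deriv H r ^ 2) ≤
      ENNReal.ofReal (R - aK) := by
    have hRaK : 0 < R - aK := sub_pos.2 haK
    calc ∫⁻ r in Ioc (R + θ₁) T, ENNReal.ofReal (r ^ 2 * f r ^ 2 * deriv H r ^ 2)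
        ≤ ∫⁻ r in Ioc (R + θ₁) T, ENNReal.ofReal ((R - aK) ^ 2) * ENNReal.ofReal (((r - aK) ^ 2)⁻¹) := by
          refine setLIntegral_mono' measurableSet_Ioc fun r hr => ?_
          rw [← ENNReal.ofReal_mul (sq_nonneg _)]
          refine ENNReal.ofReal_le_ofReal ?_
          have hrR : R < r := by linarith [hr.1]
          have hr0 : 0 < r := hR.trans hrR
          have hraK : 0 < r - aK := by linarith
          rw [hH'1 r hr.1.le hr.2]
          -- `r f ≤ r - a_K`
          have hrf : r * f r ≤ r - aK := by
            calc r * f r ≤ r * (1 - aK / r) := mul_le_mul_of_nonneg_left (hfK r hrR) hr0.le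
              _ = r - aK := by field_simp
          have hrf0 : 0 ≤ r * f r := mul_nonneg hr0.le (hf0 r).le
          have hsq : (r * f r) ^ 2 ≤ (r - aK) ^ 2 := pow_le_pow_left₀ hrf0 hrf 2
          have hne : (r - aK) ^ 2 ≠ 0 := pow_ne_zero 2 hraK.ne'
          calc r ^ 2 * f r ^ 2 * ((R - aK) / (r - aK) ^ 2) ^ 2
              = (r * f r) ^ 2 * ((R - aK) / (r - aK) ^ 2) ^ 2 := by ring
            _ ≤ (r - aK) ^ 2 * ((R - aK) / (r - aK) ^ 2) ^ 2 :=
                mul_le_mul_of_nonneg_right hsq (sq_nonneg _)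
            _ = (R - aK) ^ 2 * ((r - aK) ^ 2)⁻¹ := by field_simp
      _ ≤ ∫⁻ r in Ioc R T, ENNReal.ofReal ((R - aK) ^ 2) * ENNReal.ofReal (((r - aK) ^ 2)⁻¹) :=
          lintegral_mono_set (Ioc_subset_Ioc (by linarith) le_rfl)
      _ = ENNReal.ofReal ((R - aK) ^ 2) * ENNReal.ofReal (1 / (R - aK) - 1 / (T - aK)) := by
          rw [lintegral_const_mul' _ _ ENNReal.ofReal_ne_top, lintegral_inv_sq_shift haK (by linarith)]
      _ ≤ ENNReal.ofReal (R - aK) := by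
          rw [← ENNReal.ofReal_mul (sq_nonneg _)]
          refine ENNReal.ofReal_le_ofReal ?_
          have hTaK : 0 < T - aK := by linarith
          have h1 : 0 ≤ (R - aK) ^ 2 * (1 / (T - aK)) := by positivity
          have h2 : (R - aK) ^ 2 * (1 / (R - aK)) = R - aK := by field_simp
          calc (R - aK) ^ 2 * (1 / (R - aK) - 1 / (T - aK))
              = (R - aK) ^ 2 * (1 / (R - aK)) - (R - aK) ^ 2 * (1 / (T - aK)) := by ring
            _ ≤ (R - aK) ^ 2 * (1 / (R - aK)) - 0 := by linarith
            _ = R - aK := by rw [sub_zero, h2]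
  have hIsum : ∫⁻ r in Ioc 0 T, ENNReal.ofReal (r ^ 2 * f r ^ 2 * deriv H r ^ 2) ≤
      ENNReal.ofReal ((R + 1) ^ 2 * C_H ^ 2 * θ₁) + ENNReal.ofReal (R - aK) := by
    rw [lintegral_Ioc_eq_add hR.le (by linarith) _, lintegral_Ioc_eq_add (by linarith) hRT _, hI1,
      zero_add]
    exact add_le_add hI2 hI3
  -- the boundary term
  have hbdry : T ^ 2 * deriv f T * (f T * H T ^ 2) ≤ a₂ := by
    rw [hfT]
    obtain ⟨hH0, hH1⟩ := hH01 T
    have hk1 : f T * H T ^ 2 ≤ 1 := mul_le_one₀ (hf1 T) (sq_nonneg _) (pow_le_one₀ hH0 hH1)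
    have hk0 : 0 ≤ f T * H T ^ 2 := mul_nonneg (hf0 T).le (sq_nonneg _)
    nlinarith
  -- assemble
  rw [lintegral_Ioc_rayDensity hw hM hK hG₁c T, hid]
  calc ENNReal.ofReal (T ^ 2 * deriv f T * (f T * H T ^ 2) + ∫ r in Ioc 0 T, r ^ 2 * f r ^ 2 * deriv H r ^ 2)
      ≤ ENNReal.ofReal (a₂ + ∫ r in Ioc 0 T, r ^ 2 * f r ^ 2 * deriv H r ^ 2) :=
        ENNReal.ofReal_le_ofReal (by linarith)
    _ = ENNReal.ofReal a₂ + ∫⁻ r in Ioc 0 T, ENNReal.ofReal (r ^ 2 * f r ^ 2 * deriv H r ^ 2) := by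
        rw [ENNReal.ofReal_add ha₂0 hInn, hIeq]
    _ ≤ _ := add_le_add le_rfl hIsum

/-- **The cut-off data on `[T, 2T]`** for `G = fH` beyond the range (`f = 1 - a₂/r`, `f' = a₂/r²`,
`H = h = 1 - (R-a_K)/(r-a_K)`, `h' = (R-a_K)/(r-a_K)²`, `T ≥ 2R`): `|G'| ≤ (a₂ + 4R)/T²` and
`0 ≤ 1 - G ≤ (a₂ + 2R)/T`. [cite: LSSY2005, App. C, Thm. C.1 (C.7)] -/
theorem cutoff_data_profile_mul (hR : 0 < R) (haK0 : 0 ≤ aK) (haK : aK < R) (ha₂0 : 0 ≤ a₂)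
    (hT0 : 0 < T) (hT2 : 2 * R ≤ T) (hfc : ContDiff ℝ 1 f) (hH : ContDiff ℝ 1 H)
    (hf0 : ∀ r, 0 < f r) (hf1 : ∀ r, f r ≤ 1)
    (hf_far : ∀ r, T ≤ r → f r = 1 - a₂ / r) (hf'_far : ∀ r, T ≤ r → deriv f r = a₂ / r ^ 2)
    (hH01 : ∀ r, T ≤ r → 0 ≤ H r ∧ H r ≤ 1) (hH1 : ∀ r, T ≤ r → 1 - H r = (R - aK) / (r - aK))
    (hH' : ∀ r, T ≤ r → deriv H r = (R - aK) / (r - aK) ^ 2) :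
    (∀ r ∈ Icc T (2 * T), |deriv (fun r => f r * H r) r| ≤ (a₂ + 4 * R) / T ^ 2) ∧
      ∀ r ∈ Icc T (2 * T), 0 ≤ 1 - f r * H r ∧ 1 - f r * H r ≤ (a₂ + 2 * R) / T := by
  constructor
  · intro r hr
    have hrT : T ≤ r := hr.1
    have hr0 : 0 < r := hT0.trans_le hrT
    have hraK : 0 < r - aK := by linarith
    have hfd : HasDerivAt f (deriv f r) r := (hfc.differentiable one_ne_zero r).hasDerivAt
    have hHd : HasDerivAt H (deriv H r) r := (hH.differentiable one_ne_zero r).hasDerivAt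
    rw [(hfd.fun_mul hHd).deriv, hf'_far r hrT, hH' r hrT]
    obtain ⟨hh0, hh1⟩ := hH01 r hrT
    have hT2r : T ^ 2 ≤ r ^ 2 := pow_le_pow_left₀ hT0.le hrT 2
    have h1 : |a₂ / r ^ 2 * H r| ≤ a₂ / T ^ 2 := by
      rw [abs_mul, abs_of_nonneg (by positivity), abs_of_nonneg hh0]
      calc a₂ / r ^ 2 * H r ≤ a₂ / r ^ 2 * 1 := mul_le_mul_of_nonneg_left hh1 (by positivity)
        _ ≤ a₂ / T ^ 2 := by
            rw [mul_one]; exact div_le_div_of_nonneg_left ha₂0 (by positivity) hT2r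
    have h2 : |f r * ((R - aK) / (r - aK) ^ 2)| ≤ 4 * R / T ^ 2 := by
      rw [abs_mul, abs_of_nonneg (hf0 r).le, abs_of_nonneg (by positivity)]
      calc f r * ((R - aK) / (r - aK) ^ 2) ≤ 1 * ((R - aK) / (r - aK) ^ 2) :=
            mul_le_mul_of_nonneg_right (hf1 r) (by positivity)
        _ = (R - aK) / (r - aK) ^ 2 := one_mul _
        _ ≤ R / (r / 2) ^ 2 := by
            refine div_le_div₀ hR.le (by linarith) (by positivity) ?_
            exact pow_le_pow_left₀ (by positivity) (by linarith) 2
        _ = 4 * R / r ^ 2 := by field_simp; ring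
        _ ≤ 4 * R / T ^ 2 := div_le_div_of_nonneg_left (by positivity) (by positivity) hT2r
    calc |a₂ / r ^ 2 * H r + f r * ((R - aK) / (r - aK) ^ 2)|
        ≤ |a₂ / r ^ 2 * H r| + |f r * ((R - aK) / (r - aK) ^ 2)| := abs_add_le _ _
      _ ≤ a₂ / T ^ 2 + 4 * R / T ^ 2 := add_le_add h1 h2
      _ = (a₂ + 4 * R) / T ^ 2 := by ring
  · intro r hr
    have hrT : T ≤ r := hr.1
    have hr0 : 0 < r := hT0.trans_le hrT
    have hraK : 0 < r - aK := by linarith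
    obtain ⟨hh0, hh1⟩ := hH01 r hrT
    have hf01 : 0 ≤ f r ∧ f r ≤ 1 := ⟨(hf0 r).le, hf1 r⟩
    refine ⟨by nlinarith [mul_le_one₀ hf01.2 hh0 hh1], ?_⟩
    have hdecomp : 1 - f r * H r = (1 - f r) + f r * (1 - H r) := by ring
    rw [hdecomp, hH1 r hrT]
    have h1 : 1 - f r ≤ a₂ / T := by
      rw [hf_far r hrT, sub_sub_cancel]
      exact div_le_div_of_nonneg_left ha₂0 hT0 hrT
    have h2 : f r * ((R - aK) / (r - aK)) ≤ 2 * R / T := by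
      calc f r * ((R - aK) / (r - aK)) ≤ 1 * ((R - aK) / (r - aK)) :=
            mul_le_mul_of_nonneg_right hf01.2 (by positivity)
        _ = (R - aK) / (r - aK) := one_mul _
        _ ≤ R / (r / 2) := div_le_div₀ hR.le (by linarith) (by positivity) (by linarith)
        _ = 2 * R / r := by field_simp
        _ ≤ 2 * R / T := div_le_div_of_nonneg_left (by positivity) hT0 hrT
    calc 1 - f r + f r * ((R - aK) / (r - aK)) ≤ a₂ / T + 2 * R / T := add_le_add h1 h2
      _ = (a₂ + 2 * R) / T := by ring

end Estimates

/-! ### Lemma 3.3 with a hard core -/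

section Lemma33Core

variable {V : ℝ → ℝ≥0∞} {K R R₀ : ℝ}

/-- The technical form of `FournaisEtAl2024_lemma33_core`, for a potential which is moreover
`≥ K` at non-positive arguments (irrelevant values, `scatteringLength_congr_Ioi`).
[cite: FournaisEtAl2024, Lemma 3.3] -/
theorem FournaisEtAl2024_lemma33_core_aux (hV : Measurable V) (hR₀ : ∀ s, R₀ < s → V s = 0)
    (hK : 0 < K) (hR : 0 < R) (hRR₀ : R ≤ R₀) (hlow : ∀ r, r ≤ R → ENNReal.ofReal K ≤ V r)
    (hhigh : ∀ r, R < r → V r ≤ ENNReal.ofReal K) :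
    scatteringLength V ≤
      scatteringLength (fun r => min (V r) (ENNReal.ofReal K)) + ENNReal.ofReal (Real.sqrt (2 / K)) := by
  have hR₀pos : 0 < R₀ := hR.trans_le hRR₀
  -- the truncation `w = min(V, K)`
  obtain ⟨w, hw_def⟩ : ∃ w : ℝ → ℝ≥0∞, w = fun r => min (V r) (ENNReal.ofReal K) := ⟨_, rfl⟩
  have hmw : Measurable w := hw_def ▸ hV.min measurable_const
  have hbw : ∀ r, w r ≤ ENNReal.ofReal K := fun r => by rw [hw_def]; exact min_le_right _ _
  have hwR₀ : ∀ s, R₀ < s → w s = 0 := fun s hs => by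
    rw [hw_def]; dsimp only; rw [hR₀ s hs]; exact min_eq_left zero_le
  have hwV : ∀ s, R < s → w s = V s := fun s hs => by rw [hw_def]; exact min_eq_left (hhigh s hs)
  -- the well `w_K = K·1_{r ≤ R} ≤ w` and its scattering length `a_K`
  set wK : ℝ → ℝ≥0∞ := (Iic R).indicator fun _ => ENNReal.ofReal K with hwK
  have hmK : Measurable wK := measurable_squareWell K R
  have hbK : ∀ r, wK r ≤ ENNReal.ofReal K := squareWell_le K R
  have hKR : ∀ s, R < s → wK s = 0 := fun s hs => squareWell_eq_zero hs
  have h12 : ∀ r, wK r ≤ w r := by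
    intro r
    by_cases hr : r ∈ Iic R
    · rw [hwK, indicator_of_mem hr, hw_def]
      exact le_min (hlow r hr) le_rfl
    · rw [hwK, indicator_of_notMem hr]; exact zero_le
  set aK : ℝ := odeScatteringLength wK R with haK
  have haK_lt : aK < R := odeScatteringLength_lt hmK hbK hK.le hR
  have haK0 : 0 ≤ aK := odeScatteringLength_nonneg hmK hbK hK.le hR.le
  have hRaK : R - aK ≤ Real.sqrt (2 / K) := by
    obtain ⟨-, h⟩ := sub_scatteringLength_squareWell_le hK hR
    rw [haK, hwK, odeScatteringLength_squareWell hK hR.le]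
    exact h
  have hRaK0 : 0 < R - aK := sub_pos.2 haK_lt
  -- the profile `f` of `w` and `a₂ = a(w)`
  set a₂ : ℝ := odeScatteringLength w R₀ with ha₂
  have ha₂0 : 0 ≤ a₂ := odeScatteringLength_nonneg hmw hbw hK.le hR₀pos.le
  have ha₂w : scatteringLength w = ENNReal.ofReal a₂ :=
    scatteringLength_eq_ofReal_odeScatteringLength hmw hbw hK.le hR₀pos hwR₀
  obtain ⟨f, hf_def⟩ : ∃ f : ℝ → ℝ, f = radialProfile w R₀ := ⟨_, rfl⟩
  have hfc : ContDiff ℝ 1 f := hf_def ▸ contDiff_radialProfile hmw hbw hK.le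
  have hf0 : ∀ r, 0 < f r := fun r => hf_def ▸ radialProfile_pos hmw hbw hK.le R₀ r
  have hf1 : ∀ r, f r ≤ 1 := fun r => hf_def ▸ radialProfile_le_one hmw hbw hK.le hR₀pos hwR₀ r
  have hfK : ∀ r, R < r → f r ≤ 1 - aK / r := by
    intro r hr
    have h := radialProfile_antitone_pot hmK hmw hbK hbw hK.le h12 hR₀pos hwR₀ r
    rw [radialProfile_eq_one_sub_div hmK hbK hK.le hR.le hRR₀ hKR hr,
      odeScatteringLength_eq_of_le_of_le hmK hbK hK.le hR.le hKR hRR₀, ← hf_def] at h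
    exact h
  have hf_far : ∀ r, R₀ < r → f r = 1 - a₂ / r := fun r hr =>
    hf_def ▸ radialProfile_eq_one_sub_div hmw hbw hK.le hR₀pos.le le_rfl hwR₀ hr
  have hf'_far : ∀ r, R₀ ≤ r → deriv f r = a₂ / r ^ 2 := fun r hr =>
    hf_def ▸ deriv_radialProfile_of_ge hmw hbw hK.le hR₀pos hwR₀ hr
  have hfT : ∀ T, R₀ ≤ T → T ^ 2 * deriv f T = a₂ := fun T hT =>
    hf_def ▸ sq_mul_deriv_radialProfile hmw hbw hK.le hR₀pos hwR₀ hT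
  -- the comparison function `h(r) = (r - R)/(r - a_K)`, globalised through a smooth floor `q`
  set m : ℝ := (R + aK) / 2 with hm
  set θq : ℝ := (R - aK) / 4 with hθq
  have hθq0 : 0 < θq := by rw [hθq]; linarith
  have hmq : m + θq < R := by rw [hm, hθq]; linarith
  have hmaK : aK < m := by rw [hm]; linarith
  set q : ℝ → ℝ := glue m θq (fun _ => m) id with hq
  have hqc : ContDiff ℝ 1 q := glue_contDiff contDiff_const contDiff_id _ _
  have hq_id : ∀ r, m + θq ≤ r → q r = r := fun r hr => glue_of_ge hθq0 hr
  have hq_pos : ∀ r, 0 < q r - aK := fun r => by linarith [le_glue_const_id hθq0 m r, hmaK]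
  obtain ⟨hh, hh_def⟩ : ∃ hh : ℝ → ℝ, hh = fun r => (r - R) / (q r - aK) := ⟨_, rfl⟩
  have hhc : ContDiff ℝ 1 hh :=
    hh_def ▸ (contDiff_id.sub contDiff_const).div (hqc.sub contDiff_const) fun r => (hq_pos r).ne'
  have hh_eq : ∀ r, m + θq ≤ r → hh r = (r - R) / (r - aK) := fun r hr => by
    rw [hh_def]; dsimp only; rw [hq_id r hr]
  have hh_R : hh R = 0 := by rw [hh_def]; simp
  have hh_mem : ∀ r, R ≤ r → 0 ≤ hh r ∧ hh r ≤ 1 := by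
    intro r hr
    have hraK : 0 < r - aK := by linarith
    rw [hh_eq r (by linarith)]
    exact ⟨div_nonneg (by linarith) hraK.le, (div_le_one hraK).2 (by linarith)⟩
  have hh_one_sub : ∀ r, R ≤ r → 1 - hh r = (R - aK) / (r - aK) := by
    intro r hr
    have hraK : r - aK ≠ 0 := ne_of_gt (by linarith)
    rw [hh_eq r (by linarith), eq_div_iff hraK, sub_mul, div_mul_cancel₀ _ hraK]
    ring
  have hh_deriv : ∀ r, R ≤ r → deriv hh r = (R - aK) / (r - aK) ^ 2 := by
    intro r hr
    have hraK : r - aK ≠ 0 := ne_of_gt (by linarith)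
    have hev : hh =ᶠ[𝓝 r] fun r => (r - R) / (r - aK) := by
      filter_upwards [Ioi_mem_nhds (show m + θq < r by linarith)] with s hs
      exact hh_eq s (le_of_lt hs)
    rw [hev.deriv_eq]
    have hd : HasDerivAt (fun r : ℝ => (r - R) / (r - aK))
        ((1 * (r - aK) - (r - R) * 1) / (r - aK) ^ 2) r :=
      ((hasDerivAt_id' r).sub_const R).div ((hasDerivAt_id' r).sub_const aK) hraK
    rw [hd.deriv]
    congr 1
    ring
  -- constants: the smooth step, the inner gluing layer, the cut-off layer
  obtain ⟨Mχ, hMχ0, hMχ⟩ := exists_bound_deriv_smoothTransition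
  obtain ⟨C_H, hCH0, hCH⟩ := exists_deriv_glue_bound (contDiff_const (c := (0 : ℝ))) hhc R (R + 1)
  set D : ℝ := (a₂ + 4 * R) + Mχ * (a₂ + 2 * R) with hD
  have hD0 : 0 ≤ D := by rw [hD]; positivity
  -- it suffices to prove `a(V) ≤ a₂ + (R - a_K)`
  suffices hmain : scatteringLength V ≤ ENNReal.ofReal (a₂ + (R - aK)) by
    calc scatteringLength V ≤ ENNReal.ofReal (a₂ + (R - aK)) := hmain
      _ ≤ ENNReal.ofReal (a₂ + Real.sqrt (2 / K)) := ENNReal.ofReal_le_ofReal (by linarith)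
      _ = scatteringLength w + ENNReal.ofReal (Real.sqrt (2 / K)) := by
          rw [ha₂w, ENNReal.ofReal_add ha₂0 (Real.sqrt_nonneg _)]
      _ = _ := by rw [hw_def]
  refine ENNReal.le_of_forall_pos_le_add fun ε hε _ => ?_
  have hε0 : (0 : ℝ) < ε := NNReal.coe_pos.2 hε
  -- the width of the inner layer and the cut-off radius
  obtain ⟨θ₁, hθ₁0, hθ₁1, hθ₁E⟩ := exists_theta₁ (R := R) (C := C_H) (ε₁ := 2 * ε) (by positivity)
  set T : ℝ := max (max (R₀ + 1) (2 * R)) (8 * D ^ 2 / ε + 1) with hT_def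
  have hT1 : R₀ + 1 ≤ T := (le_max_left _ _).trans (le_max_left _ _)
  have hT2 : 2 * R ≤ T := (le_max_right _ _).trans (le_max_left _ _)
  have hT3 : 8 * D ^ 2 / ε < T := by
    have : 8 * D ^ 2 / ε + 1 ≤ T := le_max_right _ _
    linarith
  have hT0 : 0 < T := by linarith
  have hRT : R + θ₁ ≤ T := by linarith
  have hR₀T : R₀ < T := by linarith
  have hlayerE : 4 * T ^ 3 * (D / T ^ 2) ^ 2 ≤ ε / 2 := by
    have h1 : 4 * T ^ 3 * (D / T ^ 2) ^ 2 = 4 * D ^ 2 / T := by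
      field_simp
    rw [h1, div_le_iff₀ hT0]
    have h2 : 8 * D ^ 2 < T * ε := by rwa [div_lt_iff₀ hε0] at hT3
    nlinarith
  -- the functions `H = glue_R[0, h]`, `G₁ = fH`, `g = glue_T[G₁, 1]`
  obtain ⟨H, hH_def⟩ : ∃ H : ℝ → ℝ, H = glue R θ₁ (fun _ => (0 : ℝ)) hh := ⟨_, rfl⟩
  have hHc : ContDiff ℝ 1 H := hH_def ▸ glue_contDiff contDiff_const hhc _ _
  have hH_le : ∀ r, r ≤ R → H r = 0 := fun r hr => by rw [hH_def, glue_of_le hθ₁0 hr]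
  have hH_ge : ∀ r, R + θ₁ ≤ r → H r = hh r := fun r hr => by rw [hH_def, glue_of_ge hθ₁0 hr]
  have hH'_le : ∀ r, r ≤ R → deriv H r = 0 := fun r hr => by
    rw [hH_def, deriv_glue_of_le contDiff_const hhc hθ₁0 hr]; exact deriv_const r 0
  have hH'_ge : ∀ r, R + θ₁ ≤ r → deriv H r = deriv hh r := fun r hr => by
    rw [hH_def, deriv_glue_of_ge contDiff_const hhc hθ₁0 hr]
  have hH_mem : ∀ r, 0 ≤ H r ∧ H r ≤ 1 := by
    intro r
    rcases le_or_gt r R with hr | hr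
    · rw [hH_le r hr]; exact ⟨le_rfl, zero_le_one⟩
    · obtain ⟨h0, h1⟩ := hh_mem r hr.le
      have hχ0 := smoothStep_nonneg (r₀ := R) (θ := θ₁) r
      have hχ1 := smoothStep_le_one (r₀ := R) (θ := θ₁) r
      rw [hH_def, glue_eq_add]
      simp only [sub_zero, zero_add]
      exact ⟨mul_nonneg hχ0 h0, mul_le_one₀ hχ1 h0 h1⟩
  have hCH' : ∀ r ∈ Icc R (R + θ₁), |deriv H r| ≤ C_H := by
    rw [hH_def]
    exact hCH R θ₁ hθ₁0 hθ₁1 le_rfl (by linarith) (Or.inl hh_R.symm)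
  obtain ⟨g, hg_def⟩ : ∃ g : ℝ → ℝ, g = glue T T (fun r => f r * H r) fun _ => (1 : ℝ) := ⟨_, rfl⟩
  have hG₁c : ContDiff ℝ 1 fun r => f r * H r := hfc.mul hHc
  have hgc : ContDiff ℝ 1 g := hg_def ▸ glue_contDiff hG₁c contDiff_const _ _
  have hg_le : ∀ r, r ≤ T → g r = f r * H r := fun r hr => by rw [hg_def, glue_of_le hT0 hr]
  have hg'_le : ∀ r, r ≤ T → deriv g r = deriv (fun r => f r * H r) r := fun r hr => by
    rw [hg_def, deriv_glue_of_le hG₁c contDiff_const hT0 hr]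
  have hg_ge : ∀ r, 2 * T ≤ r → g r = 1 := fun r hr => by
    rw [hg_def, glue_of_ge hT0 (by linarith)]
  have hg'_ge : ∀ r, 2 * T ≤ r → deriv g r = 0 := fun r hr => by
    rw [hg_def, deriv_glue_of_ge hG₁c contDiff_const hT0 (by linarith)]; exact deriv_const r 1
  have hg0 : ∀ r, r ≤ R → g r = 0 := fun r hr => by
    rw [hg_le r (by linarith), hH_le r hr, mul_zero]
  -- the trial function
  have hφc : ContDiff ℝ 1 (radialFun g) :=
    radialFun_contDiff hgc hR fun r hr => by rw [hg0 r hr, hg0 0 hR.le]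
  have hφt : IsScatteringTrial (radialFun g) := by
    refine ⟨hφc, HasCompactSupport.intro (isCompact_closedBall (0 : Space) (2 * T)) fun x hx => ?_⟩
    rw [mem_closedBall, dist_zero_right, not_le] at hx
    simp only [radialFun, hg_ge _ hx.le, sub_self]
  have hpot : scatteringFunctional V (radialFun g) = scatteringFunctional w (radialFun g) := by
    refine lintegral_congr fun x => ?_
    by_cases hx : ‖x‖ ≤ R
    · simp [radialFun, hg0 _ hx]
    · rw [hwV _ (lt_of_not_ge hx)]
  have h4 : ENNReal.ofReal (4 * Real.pi) ≠ 0 := by rw [ENNReal.ofReal_ne_zero_iff]; positivity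
  -- (P1) the energy on `(0, T]`
  have hP1 : ∫⁻ r in Ioc 0 T, rayDensity w g r ≤
      ENNReal.ofReal a₂ + (ENNReal.ofReal ((R + 1) ^ 2 * C_H ^ 2 * θ₁) + ENNReal.ofReal (R - aK)) := by
    have hcongr : ∫⁻ r in Ioc 0 T, rayDensity w g r = ∫⁻ r in Ioc 0 T, rayDensity w (fun r => f r * H r) r := by
      refine setLIntegral_congr_fun measurableSet_Ioc fun r hr => ?_
      rw [rayDensity, rayDensity, hg_le r hr.2, hg'_le r hr.2]
    rw [hcongr]
    exact lintegral_rayDensity_profile_mul_le hmw hbw hK.le hR hθ₁0 hθ₁1 hRT haK_lt ha₂0 hf_def hf0 hf1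
      hfK (hfT T hR₀T.le) hHc hH_mem hH'_le hCH'
      (fun r hr _ => by rw [hH'_ge r hr, hh_deriv r (by linarith)])
  -- (P2) the cut-off layer `(T, 2T]`
  have hP2 : ∫⁻ r in Ioc T (2 * T), rayDensity w g r ≤ ENNReal.ofReal (ε / 2) := by
    obtain ⟨hA, hB⟩ := cutoff_data_profile_mul (f := f) (H := H) hR haK0 haK_lt ha₂0 hT0 hT2 hfc hHc
      hf0 hf1 (fun r hr => hf_far r (by linarith)) (fun r hr => hf'_far r (by linarith))
      (fun r hr => by rw [hH_ge r (by linarith)]; exact hh_mem r (by linarith))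
      (fun r hr => by rw [hH_ge r (by linarith)]; exact hh_one_sub r (by linarith))
      (fun r hr => by rw [hH'_ge r (by linarith)]; exact hh_deriv r (by linarith))
    have hE : ∀ r ∈ Icc T (2 * T), |deriv g r| ≤ D / T ^ 2 := by
      intro r hr
      rw [hg_def, hD]
      exact abs_deriv_glue_cutoff_le hG₁c hT0 hMχ hMχ0 hA hB hr
    have hwT : ∀ r, T < r → w r = 0 := fun r hr => hwR₀ r (by linarith)
    exact (lintegral_cutoff_layer_le hT0 hwT hE).trans (ENNReal.ofReal_le_ofReal hlayerE)
  -- (P3) beyond `2T`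
  have hP3 : ∫⁻ r in Ioi (2 * T), rayDensity w g r = 0 := by
    rw [setLIntegral_congr_fun measurableSet_Ioi (g := fun _ => 0) fun r hr => ?_, lintegral_zero]
    have hr : 2 * T < r := hr
    rw [rayDensity_of_eq_zero (hwR₀ r (by linarith)), hg'_ge r hr.le]
    simp
  -- assembly
  have hθE : (R + 1) ^ 2 * C_H ^ 2 * θ₁ ≤ ε / 2 := by linarith
  calc scatteringLength V
      ≤ (ENNReal.ofReal (4 * Real.pi))⁻¹ * scatteringFunctional V (radialFun g) := scatteringLength_le hφt
    _ = ∫⁻ r in Ioi 0, rayDensity w g r := by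
        rw [hpot, scatteringFunctional_radialFun hgc hmw, ← mul_assoc,
          ENNReal.inv_mul_cancel h4 ENNReal.ofReal_ne_top, one_mul]
    _ = (∫⁻ r in Ioc 0 T, rayDensity w g r) + ((∫⁻ r in Ioc T (2 * T), rayDensity w g r) +
          ∫⁻ r in Ioi (2 * T), rayDensity w g r) := by
        rw [lintegral_Ioi_eq_add hT0.le, lintegral_Ioi_eq_add (show T ≤ 2 * T by linarith)]
    _ ≤ ENNReal.ofReal a₂ + (ENNReal.ofReal ((R + 1) ^ 2 * C_H ^ 2 * θ₁) + ENNReal.ofReal (R - aK)) +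
          (ENNReal.ofReal (ε / 2) + 0) := by
        rw [hP3]; exact add_le_add hP1 (add_le_add hP2 le_rfl)
    _ ≤ ENNReal.ofReal a₂ + (ENNReal.ofReal (ε / 2) + ENNReal.ofReal (R - aK)) +
          (ENNReal.ofReal (ε / 2) + 0) := by
        gcongr
    _ = ENNReal.ofReal (a₂ + (R - aK)) + ε := by
        rw [add_zero, ← ENNReal.ofReal_add (by positivity) hRaK0.le,
          ← ENNReal.ofReal_add ha₂0 (by positivity), ← ENNReal.ofReal_add (by positivity) (by positivity),
          ← ENNReal.ofReal_coe_nnreal, ← ENNReal.ofReal_add (by positivity) NNReal.zero_le_coe]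
        congr 1
        ring

/-- **FGJMOT Lemma 3.3 for potentials with a hard core.** Let `V : ℝ → [0, ∞]` be measurable and
vanish beyond `R₀`, `K > 0`, `0 < R ≤ R₀`, with `V ≥ K` on `(0, R]` and `V ≤ K` on `(R, ∞)` — i.e.
`{V > K} ⊆ B(0, R) ⊆ {V ≥ K}`, as for the radially non-increasing `V` of [FournaisEtAl2024,
Lemma 3.3] with `R = R_K`; `V` may take the value `+∞` (hard core). Then
`a(V) ≤ a(min(V, K)) + √(2/K)` for the variational scattering lengths (the paper prints the bound
`2√2/√K`; and `a(min(V,K)) ≤ a(V)` by monotonicity). [cite: FournaisEtAl2024, Lemma 3.3, (3.7)–(3.9)] -/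
theorem FournaisEtAl2024_lemma33_core (hV : Measurable V) (hR₀ : ∀ s, R₀ < s → V s = 0)
    (hK : 0 < K) (hR : 0 < R) (hRR₀ : R ≤ R₀) (hlow : ∀ r, 0 < r → r ≤ R → ENNReal.ofReal K ≤ V r)
    (hhigh : ∀ r, R < r → V r ≤ ENNReal.ofReal K) :
    scatteringLength V ≤
      scatteringLength (fun r => min (V r) (ENNReal.ofReal K)) + ENNReal.ofReal (Real.sqrt (2 / K)) := by
  -- modify `V` at non-positive arguments (a null set for the functional)
  set V' : ℝ → ℝ≥0∞ := fun r => if 0 < r then V r else ⊤ with hV'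
  have hagree : ∀ r, 0 < r → V r = V' r := fun r hr => by rw [hV']; dsimp only; rw [if_pos hr]
  have hmV' : Measurable V' := Measurable.ite measurableSet_Ioi hV measurable_const
  have hR₀' : ∀ s, R₀ < s → V' s = 0 := fun s hs => by
    rw [← hagree s ((hR.trans_le hRR₀).trans hs)]; exact hR₀ s hs
  have hlow' : ∀ r, r ≤ R → ENNReal.ofReal K ≤ V' r := fun r hr => by
    by_cases h0 : 0 < r
    · rw [← hagree r h0]; exact hlow r h0 hr
    · rw [hV']; dsimp only; rw [if_neg h0]; exact le_top
  have hhigh' : ∀ r, R < r → V' r ≤ ENNReal.ofReal K := fun r hr => by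
    rw [← hagree r (hR.trans hr)]; exact hhigh r hr
  rw [scatteringLength_congr_Ioi hagree,
    scatteringLength_congr_Ioi (v₁ := fun r => min (V r) (ENNReal.ofReal K))
      (v₂ := fun r => min (V' r) (ENNReal.ofReal K)) fun r hr => by simp only [hagree r hr]]
  exact FournaisEtAl2024_lemma33_core_aux hmV' hR₀' hK hR hRR₀ hlow' hhigh'

/-- Real form: `a(V) - a(min(V,K)) ≤ √(2/K)` (both scattering lengths are finite, the potentials
having finite range). [cite: FournaisEtAl2024, Lemma 3.3] -/
theorem FournaisEtAl2024_lemma33_core_toReal (hV : Measurable V) (hR₀ : ∀ s, R₀ < s → V s = 0)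
    (hK : 0 < K) (hR : 0 < R) (hRR₀ : R ≤ R₀) (hlow : ∀ r, 0 < r → r ≤ R → ENNReal.ofReal K ≤ V r)
    (hhigh : ∀ r, R < r → V r ≤ ENNReal.ofReal K) :
    (scatteringLength V).toReal - (scatteringLength fun r => min (V r) (ENNReal.ofReal K)).toReal ≤
      Real.sqrt (2 / K) := by
  have h := FournaisEtAl2024_lemma33_core hV hR₀ hK hR hRR₀ hlow hhigh
  have hfinV : scatteringLength V ≠ ⊤ := scatteringLength_ne_top_of_finiteRange hR₀
  have hfin : scatteringLength (fun r => min (V r) (ENNReal.ofReal K)) ≠ ⊤ :=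
    ne_top_of_le_ne_top hfinV (scatteringLength_mono fun _ => min_le_left _ _)
  have h' := (ENNReal.toReal_le_toReal hfinV (ENNReal.add_ne_top.2 ⟨hfin, ENNReal.ofReal_ne_top⟩)).2 h
  rw [ENNReal.toReal_add hfin ENNReal.ofReal_ne_top, ENNReal.toReal_ofReal (Real.sqrt_nonneg _)] at h'
  linarith

end Lemma33Core

end Literature.MathematicalPhysics.QuantumManyBody.BoseGas
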